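import Summits.QuantumFields.QCD.Theses.HeatSlicedQuarks
import Summits.QuantumFields.QCD.Theorems.HeatSlicedQuarksInterleavedHeatSliceFlowParametrixDiagonalLog
import Summits.QuantumFields.QCD.Theorems.HeatSlicedQuarksInterleavedHeatSliceFlowStubDuhamelEntrywise
import Summits.QuantumFields.QCD.Theorems.HeatSlicedQuarksInterleavedHeatSliceFlowStubCoveringPeriodization
import Summits.QuantumFields.QCD.Theorems.HeatSlicedQuarksDaviesGaffneyWilson
import Summits.QuantumFields.QCD.Theorems.HeatSlicedQuarksTracedQuadraticParametrixMaximalRegularity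
import Summits.QuantumFields.QCD.Theorems.HeatSlicedQuarksTracedQuadraticParametrixTracedSplittingIdentity
import Summits.QuantumFields.QCD.Theorems.HeatSlicedQuarksTracedQuadraticParametrixFreeTimeDerivativeProfile
import Summits.QuantumFields.QCD.Theorems.HeatSlicedQuarksTracedQuadraticParametrixTracedCoreAssembly
import Summits.QuantumFields.QCD.Theorems.HeatSlicedQuarksTracedQuadraticParametrixInteriorTracedAssembly
import Summits.QuantumFields.QCD.Theorems.HeatSlicedQuarksTracedQuadraticParametrixFirstOrderTracedPairing
import Summits.QuantumFields.QCD.Theorems.HeatSlicedQuarksTracedQuadraticParametrixDerivativeColumnIdentification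

/-!
# Line `Sketch` — checked skeleton for crux stmt-QuantumFields-17985
(`Summit.QuantumFields.QCD.Theses.HeatSlicedQuarks.TracedQuadraticParametrix`, rank-6 crux of route HeatSlicedQuarks;
lead prover-line-stmt-QuantumFields-17985-0, 2026-08-17, reshape r1 of the round-1 ideas file `SketchR1I1.lean`)

Crux: under GLOBAL `(ε/r²)²`-smallness of the plaquette deficits (`1 ≤ r ≤ L`, `m ∈ [-1/2,1]`) the colour–spin TRACE
`Φ_U(t) = Σ_{aα} Re [e^{-tH_U} − e^{-tH_1}]((x,a,α),(x,a,α))`, `H = D_Wᴴ D_W`, is second order: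
`|Φ_U(t)| ≤ C (ε/r²)² + C e^{-cL²/(t(1+log t)²)}/t²` for `1 ≤ t ≤ r²`.

## The line (card `tstar-squaring-bootstrap`, reshaped: no bootstrap, one derivative column law instead)

Write `δ = ε/r²`, `K_V(s) = e^{-s D_W(V)ᴴ D_W(V)}`, `Δ(s) = K_W(s) − K_1(s)`, `E = D_W(W) − D_W(1)`,
`V = H_W − H_1 = D_1ᴴ E + Eᴴ D_W`, and `e_p` for the 12 basis vectors at the site `x`.

* LATE regime `t(1+log t)² > L²`: `|Φ| ≤ 12 C_late/t²` (landed `stub_parametrixLate`, 8871 twice) is absorbed by the tail.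
* CORE regime `t(1+log t)² ≤ L²` (`stub_tracedCoreAssembly`): periodize on the cover `T_{NL}`, `NL ≥ A r²/ε`
  (landed `stub_coveringPeriodization`); the diagonal lift is the INTERIOR bound below; the deck images are bounded by the
  landed U-uniform Davies–Gaffney estimate (`DaviesGaffneyWilson_proof`) and summed:
  `Σ_{images} e^{-c d²/(t+d)} ≤ C e^{-cL²/(t+L)} ≤ C/L⁴` in the core regime, and `1/L⁴ ≤ ε⁻² (ε/r²)²` since `r ≤ L`.
* INTERIOR bound on tori `L ≥ A r²/ε` (`stub_interiorTracedAssembly`): the colour trace is gauge invariant (landed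
  `stub_gaugeCovariance`), so pass to the global comb gauge `W` of `U` centred at `x` (landed `stub_globalCombGauge`:
  link deficits `≤ C_A (d(x,z)+1)² δ²`).  With `t = 2s` the exact T*T SPLITTING IDENTITY (`stub_tracedSplittingIdentity`)
  `Φ_W(2s) = Σ_p ‖Δ(s)e_p‖² − 2 Re ∫₀ˢ Σ_p (K_1(2s−τ) V K_W(τ))(p,p) dτ`
  reduces the crux to three bounds, uniformly in `s ≤ r²/2`:
  (a) `Σ_p ‖Δ(s)e_p‖² ≤ 12 C_c² δ²` — the LANDED linear column law `stub_columnIdentification` (p111007);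
  (b) FIRST ORDER (`K_W(τ) ↦ K_1(τ)`): `K_1, D_1` are colour-trivial, so only colour traces of the blocks of `E` enter,
      and `|tr(W_e − 1)| ≤ (16/3)(3 − Re tr W_e) ≤ C C_A (d+1)² δ²` for `W_e ∈ SU(3)`; Cauchy–Schwarz with the landed free
      profiles and weighted moments gives `≤ C δ²/√((1+σ)(1+τ))` (`stub_firstOrderTracedPairing`), `∫₀ˢ ≤ 2Cδ²`;
  (c) SECOND ORDER (`K_W(τ) ↦ Δ(τ)`): `(K_1(σ) V Δ(τ))(p,p) = ⟨EᴴD_1K_1(σ)e_p, Δ(τ)e_p⟩ + ⟨E K_1(σ)e_p, D_W Δ(τ) e_p⟩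
      ≤ (δA₁/(1+σ))·C_c δ + (δA₁/√(1+σ))·C_D δ/√(1+τ)` with `σ = 2s − τ ≥ s`, so `∫₀ˢ ≤ C δ²`, given (a), the landed hopping
      bounds, and the DERIVATIVE COLUMN LAW `‖D_W Δ(τ) e_p‖₂ ≤ C_D δ/√(1+τ)` (`stub_derivativeColumnIdentification`).
* The derivative column law is the line's one new analytic estimate.  Column Duhamel (landed `stub_duhamelEntrywise`)
  `D_WΔ(τ)e = −∫₀^τ D K(τ−u) Dᴴ [E K_1(u) e] du − ∫₀^τ D K(τ−u) [Eᴴ D_1 K_1(u) e] du`.  The second integral: late half by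
  `‖D K(σ')‖ ≤ (2eσ')^{-1/2}` (landed `stub_freeSmoothing`), early half by the `ℓ¹→ℓ²` bound
  `‖D K(σ')e_q‖₂² = (H K(2σ'))(q,q) ≤ (eσ')⁻¹ K(σ')(q,q) ≤ C₈₈₇₁/(e σ'³)` (spectral calculus + the closed crux 8871 at every
  site).  The first integral carries BOTH Dirac factors on one kernel (`‖DK(σ')Dᴴ‖ ≍ 1/σ'`, the `∫dσ'/σ' = log t` the
  crux docstring fears): its early half costs `(1/τ)·∫₀^{τ/2} δ/√(1+u) ≲ δ/√τ`, and its late half is FROZEN at `u = τ`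
  by parabolic maximal regularity (`stub_maximalRegularity`: `D(∫₀^{τ/2}K)Dᴴ = 1 − e^{-(τ/2)DDᴴ}` has norm ≤ 2, and the
  remainder pays only the time-Lipschitz modulus of `u ↦ E K_1(u) e`), the modulus coming from the FREE time-derivative
  profile `|(H_1K_1(v))(z,x)| ≤ C e^{-cvm²}/(1+v+d²)³` (`stub_freeTimeDerivativeProfile`) and the landed moments.  No log.

## Registered stubs (7) and who holds them
`stub_tracedSplittingIdentity` (S, exact identity), `stub_maximalRegularity` (S/M, exact matrix analysis),
`stub_firstOrderTracedPairing` (M), `stub_freeTimeDerivativeProfile` (M), `stub_derivativeColumnIdentification` (L, LEAD),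
`stub_interiorTracedAssembly` (M/L bookkeeping, pattern `stub_interiorAssembly` + `stub_columnIdentification`),
`stub_tracedCoreAssembly` (M/L bookkeeping, pattern `stub_periodizationAssembly` + `stub_imageSum`).
`TracedQuadraticParametrix_of` (§2, fully proved) concludes the crux BY NAME from them and the landed inputs.
-/

noncomputable section

namespace Summit.QuantumFields.QCD.Cruxes.TracedQuadraticParametrix.Sketch

open Literature.MathematicalPhysics.QuantumLattice Literature.MathematicalPhysics.QuantumFieldTheory
  Literature.Probability.LatticeModels
open Summit.QuantumFields.QCD.Theses.HeatSlicedQuarks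
open Summit.QuantumFields.QCD.Cruxes.InterleavedHeatSliceFlow.Sketch
open Summit.QuantumFields.QCD.Theorems.SmallFieldUltracontractivity.Negative
open MeasureTheory intervalIntegral
open scoped Matrix ComplexConjugate

/-! ### §1 The seven registered stubs of the line — all LANDED (imported above, theorems of this namespace) -/

-- `stub_tracedSplittingIdentity`: LANDED (imported above).

-- `stub_maximalRegularity`: LANDED (imported above).

-- `stub_freeTimeDerivativeProfile`: LANDED (imported above).

-- `stub_firstOrderTracedPairing`: LANDED (imported above).

-- `stub_derivativeColumnIdentification`: LANDED (imported above).

-- `stub_interiorTracedAssembly`: LANDED (imported above).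

-- `stub_tracedCoreAssembly`: LANDED (imported above).

/-! ### §2 Composition (everything below is kernel-closed) -/

/-- The core-regime traced bound, composed from the seven stubs and the landed Davies–Gaffney estimate. -/
theorem tracedCoreBound_holds :
    ∃ ε : ℝ, 0 < ε ∧ ∃ C : ℝ, ∀ (L : ℕ) [NeZero L]
      (U : GaugeConfig 4 L (SU3)) (m : ℝ), m ∈ Set.Icc (-(1 / 2 : ℝ)) 1 →
      ∀ (r : ℕ), 1 ≤ r → r ≤ L →
      (∀ (y : TorusSite 4 L) (μ ν : Fin 4),
        3 - ((fundamentalRep (Fin 3)) (plaquetteHolonomy U y μ ν)).trace.re ≤ (ε / (r : ℝ) ^ 2) ^ 2) →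
      ∀ (t : ℝ), 1 ≤ t → t ≤ (r : ℝ) ^ 2 → t * (1 + Real.log t) ^ 2 ≤ (L : ℝ) ^ 2 → ∀ (x : TorusSite 4 L),
        |(∑ a : Fin 3, ∑ α : Fin 4, ((NormedSpace.exp (-(t : ℂ) •
              ((wilsonDirac (fundamentalRep (Fin 3)) U m 1)ᴴ * wilsonDirac (fundamentalRep (Fin 3)) U m 1)))
              (x, a, α) (x, a, α)).re) -
          (∑ a : Fin 3, ∑ α : Fin 4, ((NormedSpace.exp (-(t : ℂ) •
              ((wilsonDirac (fundamentalRep (Fin 3))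
                  (freeCfg L) m 1)ᴴ *
                wilsonDirac (fundamentalRep (Fin 3))
                  (freeCfg L) m 1)))
              (x, a, α) (x, a, α)).re)| ≤
          C * (ε / (r : ℝ) ^ 2) ^ 2 :=
  stub_tracedCoreAssembly Summit.QuantumFields.QCD.Theorems.DaviesGaffneyWilson_proof
    (stub_interiorTracedAssembly stub_derivativeColumnIdentification stub_firstOrderTracedPairing
      stub_tracedSplittingIdentity)

/-- Traced late bound: outside any regime, `|Φ_U(t) − Φ_1(t)| ≤ 12 C_late/t²` (landed `stub_parametrixLate`,
i.e. the closed crux 8871 twice, summed over the 12 colour–spin indices; `|Re z − Re w| ≤ ‖z − w‖`). -/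
theorem tracedLate_holds :
    ∃ ε : ℝ, 0 < ε ∧ ∃ C : ℝ, ∀ (L : ℕ) [NeZero L]
      (U : GaugeConfig 4 L (Matrix.specialUnitaryGroup (Fin 3) ℂ)) (m : ℝ), m ∈ Set.Icc (-(1 / 2 : ℝ)) 1 →
      ∀ (r : ℕ), 1 ≤ r → r ≤ L →
      (∀ (y : TorusSite 4 L) (μ ν : Fin 4),
        3 - ((fundamentalRep (Fin 3)) (plaquetteHolonomy U y μ ν)).trace.re ≤ (ε / (r : ℝ) ^ 2) ^ 2) →
      ∀ (t : ℝ), 1 ≤ t → t ≤ (r : ℝ) ^ 2 → ∀ (x : TorusSite 4 L),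
        |(∑ a : Fin 3, ∑ α : Fin 4, ((NormedSpace.exp (-(t : ℂ) •
              ((wilsonDirac (fundamentalRep (Fin 3)) U m 1)ᴴ * wilsonDirac (fundamentalRep (Fin 3)) U m 1)))
              (x, a, α) (x, a, α)).re) -
          (∑ a : Fin 3, ∑ α : Fin 4, ((NormedSpace.exp (-(t : ℂ) •
              ((wilsonDirac (fundamentalRep (Fin 3))
                  (fun _ : Edge 4 L => (1 : Matrix.specialUnitaryGroup (Fin 3) ℂ)) m 1)ᴴ *
                wilsonDirac (fundamentalRep (Fin 3))
                  (fun _ : Edge 4 L => (1 : Matrix.specialUnitaryGroup (Fin 3) ℂ)) m 1)))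
              (x, a, α) (x, a, α)).re)| ≤
          C / t ^ 2 := by
  obtain ⟨ε, hε, C, hC⟩ := stub_parametrixLate
  refine ⟨ε, hε, 12 * C, ?_⟩
  intro L _ U m hm r hr hrL hsmall t ht htr x
  rw [← Finset.sum_sub_distrib]
  have hinner : ∀ a : Fin 3,
      |∑ α : Fin 4, (((NormedSpace.exp (-(t : ℂ) •
            ((wilsonDirac (fundamentalRep (Fin 3)) U m 1)ᴴ * wilsonDirac (fundamentalRep (Fin 3)) U m 1)))
            (x, a, α) (x, a, α)).re) -
          ∑ α : Fin 4, ((NormedSpace.exp (-(t : ℂ) •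
            ((wilsonDirac (fundamentalRep (Fin 3))
                (fun _ : Edge 4 L => (1 : Matrix.specialUnitaryGroup (Fin 3) ℂ)) m 1)ᴴ *
              wilsonDirac (fundamentalRep (Fin 3))
                (fun _ : Edge 4 L => (1 : Matrix.specialUnitaryGroup (Fin 3) ℂ)) m 1)))
            (x, a, α) (x, a, α)).re| ≤ ∑ _α : Fin 4, C / t ^ 2 := by
    intro a
    rw [← Finset.sum_sub_distrib]
    refine (Finset.abs_sum_le_sum_abs _ _).trans (Finset.sum_le_sum fun α _ => ?_)
    rw [← Complex.sub_re]
    exact (Complex.abs_re_le_norm _).trans (hC L U m hm r hr hrL hsmall t ht htr x a a α α)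
  calc _ ≤ ∑ a : Fin 3, |∑ α : Fin 4, (((NormedSpace.exp (-(t : ℂ) •
            ((wilsonDirac (fundamentalRep (Fin 3)) U m 1)ᴴ * wilsonDirac (fundamentalRep (Fin 3)) U m 1)))
            (x, a, α) (x, a, α)).re) -
          ∑ α : Fin 4, ((NormedSpace.exp (-(t : ℂ) •
            ((wilsonDirac (fundamentalRep (Fin 3))
                (fun _ : Edge 4 L => (1 : Matrix.specialUnitaryGroup (Fin 3) ℂ)) m 1)ᴴ *
              wilsonDirac (fundamentalRep (Fin 3))
                (fun _ : Edge 4 L => (1 : Matrix.specialUnitaryGroup (Fin 3) ℂ)) m 1)))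
            (x, a, α) (x, a, α)).re| := Finset.abs_sum_le_sum_abs _ _
    _ ≤ ∑ _a : Fin 3, ∑ _α : Fin 4, C / t ^ 2 := Finset.sum_le_sum fun a _ => hinner a
    _ = 12 * C / t ^ 2 := by
        simp only [Finset.sum_const, Finset.card_univ, Fintype.card_fin, nsmul_eq_mul]
        ring

/-- **The skeleton IS the crux proof modulo the declared stubs**: `TracedQuadraticParametrix_of` concludes
`HeatSlicedQuarks.TracedQuadraticParametrix` BY NAME from the seven `stub_*` of §1 (through `tracedCoreBound_holds`) and
the landed inputs: the core bound inside `t(1+log t)² ≤ L²`, the traced late bound outside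
(`C/t² ≤ C e · e^{-L²/(t(1+log t)²)}/t²`, landed `windingLog_const_le'`); `c = 1`, `ε = min ε_core ε_late`. -/
theorem TracedQuadraticParametrix_of :
    Summit.QuantumFields.QCD.Theses.HeatSlicedQuarks.TracedQuadraticParametrix := by
  obtain ⟨ε₁, hε₁, C₁, h₁⟩ := tracedCoreBound_holds
  obtain ⟨ε₂, hε₂, C₂, h₂⟩ := tracedLate_holds
  set ε : ℝ := min ε₁ ε₂ with hεdef
  have hε : 0 < ε := lt_min hε₁ hε₂
  have hεle₁ : ε ≤ ε₁ := min_le_left _ _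
  have hεle₂ : ε ≤ ε₂ := min_le_right _ _
  set C : ℝ := max (max (C₁ * ε₁ ^ 2 / ε ^ 2) (max C₂ 0 * Real.exp 1)) 0 with hCdef
  have hC0 : 0 ≤ C := le_max_right _ _
  have hCge₁ : C₁ * ε₁ ^ 2 / ε ^ 2 ≤ C := (le_max_left _ _).trans (le_max_left _ _)
  have hCge₂ : max C₂ 0 * Real.exp 1 ≤ C := (le_max_right _ _).trans (le_max_left _ _)
  refine ⟨ε, hε, C, 1, one_pos, ?_⟩
  intro L _ U m hm r hr hrL hsmall t ht htr x
  have hr0 : (0 : ℝ) < (r : ℝ) := by exact_mod_cast (Nat.lt_of_lt_of_le Nat.zero_lt_one hr)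
  have hr2 : (0 : ℝ) < (r : ℝ) ^ 2 := by positivity
  have ht0 : (0 : ℝ) < t := lt_of_lt_of_le one_pos ht
  have ht2 : (0 : ℝ) < t ^ 2 := by positivity
  have hφ : 0 < t * (1 + Real.log t) ^ 2 := regimeFun_pos' ht
  -- smallness with `ε` implies smallness with `ε₁` and with `ε₂`
  have hmono : ∀ ε' : ℝ, ε ≤ ε' → ∀ (y : TorusSite 4 L) (μ ν : Fin 4),
      3 - ((fundamentalRep (Fin 3)) (plaquetteHolonomy U y μ ν)).trace.re ≤ (ε' / (r : ℝ) ^ 2) ^ 2 := by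
    intro ε' hle y μ ν
    refine (hsmall y μ ν).trans ?_
    have h1 : 0 ≤ ε / (r : ℝ) ^ 2 := div_nonneg hε.le hr2.le
    have h2 : ε / (r : ℝ) ^ 2 ≤ ε' / (r : ℝ) ^ 2 := div_le_div_of_nonneg_right hle hr2.le
    exact pow_le_pow_left₀ h1 h2 2
  -- both right-hand terms are nonnegative
  have hT1 : 0 ≤ C * (ε / (r : ℝ) ^ 2) ^ 2 := mul_nonneg hC0 (sq_nonneg _)
  have hT2 : 0 ≤ C * Real.exp (-(1 * (L : ℝ) ^ 2 / (t * (1 + Real.log t) ^ 2))) / t ^ 2 :=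
    div_nonneg (mul_nonneg hC0 (Real.exp_pos _).le) ht2.le
  by_cases hreg : t * (1 + Real.log t) ^ 2 ≤ (L : ℝ) ^ 2
  · -- core regime
    have hc := h₁ L U m hm r hr hrL (hmono ε₁ hεle₁) t ht htr hreg x
    refine hc.trans ?_
    have hstep : C₁ * (ε₁ / (r : ℝ) ^ 2) ^ 2 ≤ C * (ε / (r : ℝ) ^ 2) ^ 2 := by
      have hq : 0 ≤ ((r : ℝ) ^ 2)⁻¹ ^ 2 := sq_nonneg _
      have key : C₁ * (ε₁ / (r : ℝ) ^ 2) ^ 2 = (C₁ * ε₁ ^ 2 / ε ^ 2) * ε ^ 2 * ((r : ℝ) ^ 2)⁻¹ ^ 2 := by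
        field_simp
      have key' : C * (ε / (r : ℝ) ^ 2) ^ 2 = C * ε ^ 2 * ((r : ℝ) ^ 2)⁻¹ ^ 2 := by
        field_simp
      rw [key, key']
      exact mul_le_mul_of_nonneg_right (mul_le_mul_of_nonneg_right hCge₁ (sq_nonneg _)) hq
    linarith
  · -- winding regime: `L² < t (1 + log t)²`
    push Not at hreg
    have hlate := h₂ L U m hm r hr hrL (hmono ε₂ hεle₂) t ht htr x
    refine hlate.trans ?_
    have hstep : C₂ / t ^ 2 ≤ C * Real.exp (-(1 * (L : ℝ) ^ 2 / (t * (1 + Real.log t) ^ 2))) / t ^ 2 := by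
      rw [one_mul]
      refine (windingLog_const_le' (C := C₂) ht0 hφ hreg.le).trans ?_
      exact div_le_div_of_nonneg_right (mul_le_mul_of_nonneg_right hCge₂ (Real.exp_pos _).le) ht2.le
    linarith

end Summit.QuantumFields.QCD.Cruxes.TracedQuadraticParametrix.Sketch

end
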